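import Summits.HubbardSuperconductivity.HubbardSuperconductivity.Theorems.BalabanIRBirBdGPhaseCoercivityStencils

/-!
# Route BalabanIR — crux 3 `BirBdGPhaseCoercivity` (item `stmt-HubbardSuperconductivity-2081`):
# X. Integer frequencies on the discrete torus: characters as exponentials, aliasing-free sums,
# and the `d+id` gap as an eight-term character sum

Toolkit for the one-loop symbol inequality (★) of the frozen-metric reduction
(`BirBdG.coercive_of_symbolIneq`): an integer frequency `ρ ∈ ℤ²` defines the character
`k ↦ χ_ρ̄(k) = exp(i ρ·θ_k)`, `θ_k = 2πk/L` (`torusChar_intFreq_eq_exp`); its sum over the grid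
`(ℤ/L)²` is `L²` if `ρ = 0` and `0` if `0 < |ρ|_∞ < L` (`sum_torusChar_intFreq`, aliasing-free
orthogonality); and the gap function `Δ(θ) = 2Δ₁(cos θ₀ - cos θ₁) - 4iΔ₂ sin θ₀ sin θ₁` is the
character sum `Σ_{r ∈ B} c_r exp(i r·θ)` over the eight bond vectors
`B = {±e₀, ±e₁, ±(e₀+e₁), ±(e₀-e₁)}` with `c = (Δ₁, Δ₁, -Δ₁, -Δ₁, iΔ₂, iΔ₂, -iΔ₂, -iΔ₂)`
(`gap_eq_sum_bondCoeff_mul_exp`).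

References: Friedli–Velenik 2017, §10.4 (characters of the discrete torus). No definition is
introduced (the bond set and coefficients are written out as literals).
-/

noncomputable section

namespace Summit.HubbardSuperconductivity.HubbardSuperconductivity.Theorems

namespace BirBdG

open Matrix Finset Literature.Probability.LatticeModels
open scoped ComplexConjugate

variable {L : ℕ} [NeZero L]

/-! ### Integer frequencies -/

/-- **Characters at integer frequencies are exponentials of the lattice momenta**:
`χ_{ρ̄}(k) = exp(i (ρ₀ θ₀ + ρ₁ θ₁))`, `θᵢ = 2π kᵢ/L`, `ρ̄ = ρ mod L`. [cite: FriedliVelenik2017, §10.4] -/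
theorem torusChar_intFreq_eq_exp (ρ : ℤ × ℤ) (k : TorusSite 2 L) :
    torusChar (![((ρ.1 : ℤ) : ZMod L), ((ρ.2 : ℤ) : ZMod L)] : TorusSite 2 L) k =
      Complex.exp (Complex.I * ((ρ.1 * latticeMomentum L k 0 + ρ.2 * latticeMomentum L k 1 : ℝ) : ℂ)) := by
  unfold torusChar
  rw [Fin.prod_univ_two]
  simp only [Matrix.cons_val_zero, Matrix.cons_val_one]
  have hchar : ∀ (j : ℤ) (x : ZMod L), (ZMod.stdAddChar ((j : ZMod L) * x) : ℂ) =
      Complex.exp (Complex.I * ((j * (2 * Real.pi * (x.val : ℝ) / L) : ℝ) : ℂ)) := by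
    intro j x
    have : (j : ZMod L) * x = ((j * (x.val : ℤ) : ℤ) : ZMod L) := by
      push_cast
      rw [ZMod.natCast_zmod_val]
    rw [this, ZMod.stdAddChar_coe]
    congr 1
    push_cast
    ring
  rw [hchar, hchar, ← Complex.exp_add]
  congr 1
  simp only [latticeMomentum]
  push_cast
  ring

omit [NeZero L] in
/-- An integer of absolute value `< L` vanishes in `ZMod L` only if it is `0`. [folklore] -/
theorem int_eq_zero_of_zmod_eq_zero {j : ℤ} (hj : |j| < L) (h : ((j : ℤ) : ZMod L) = 0) : j = 0 := by
  rw [ZMod.intCast_zmod_eq_zero_iff_dvd] at h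
  by_contra hne
  have h1 := Int.le_of_dvd (abs_pos.2 hne) ((dvd_abs _ _).2 h)
  omega

/-- **Aliasing-free orthogonality**: for an integer frequency `ρ` with `|ρ₀|, |ρ₁| < L`,
`Σ_k χ_ρ̄(k) = L²` if `ρ = 0` and `0` otherwise. [cite: FriedliVelenik2017, §10.4] -/
theorem sum_torusChar_intFreq (ρ : ℤ × ℤ) (h0 : |ρ.1| < L) (h1 : |ρ.2| < L) :
    ∑ k : TorusSite 2 L, torusChar (![((ρ.1 : ℤ) : ZMod L), ((ρ.2 : ℤ) : ZMod L)] : TorusSite 2 L) k =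
      if ρ = 0 then ((L : ℂ) ^ 2) else 0 := by
  rw [sum_torusChar_right]
  by_cases hρ : ρ = 0
  · subst hρ
    have : (![((0 : ℤ) : ZMod L), ((0 : ℤ) : ZMod L)] : TorusSite 2 L) = 0 := by
      ext i; fin_cases i <;> simp
    rw [show ((0 : ℤ × ℤ).1 : ℤ) = 0 from rfl, show ((0 : ℤ × ℤ).2 : ℤ) = 0 from rfl, this]
    simp
  · have hne : (![((ρ.1 : ℤ) : ZMod L), ((ρ.2 : ℤ) : ZMod L)] : TorusSite 2 L) ≠ 0 := by
      intro h
      apply hρ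
      have e0 := congrFun h 0
      have e1 := congrFun h 1
      simp only [Matrix.cons_val_zero, Matrix.cons_val_one, Pi.zero_apply] at e0 e1
      exact Prod.ext (int_eq_zero_of_zmod_eq_zero h0 e0) (int_eq_zero_of_zmod_eq_zero h1 e1)
    simp [hρ, hne]

omit [NeZero L] in
/-- Casting integer frequencies to the torus is additive. [folklore] -/
theorem intFreq_add (ρ σ : ℤ × ℤ) :
    (![(((ρ + σ).1 : ℤ) : ZMod L), (((ρ + σ).2 : ℤ) : ZMod L)] : TorusSite 2 L) =
      (![((ρ.1 : ℤ) : ZMod L), ((ρ.2 : ℤ) : ZMod L)] : TorusSite 2 L) +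
        ![((σ.1 : ℤ) : ZMod L), ((σ.2 : ℤ) : ZMod L)] := by
  ext i; fin_cases i <;> simp

omit [NeZero L] in
/-- Casting integer frequencies to the torus is compatible with negation. [folklore] -/
theorem intFreq_neg (ρ : ℤ × ℤ) :
    (![(((-ρ).1 : ℤ) : ZMod L), (((-ρ).2 : ℤ) : ZMod L)] : TorusSite 2 L) =
      -(![((ρ.1 : ℤ) : ZMod L), ((ρ.2 : ℤ) : ZMod L)] : TorusSite 2 L) := by
  ext i; fin_cases i <;> simp

/-! ### The gap function as an eight-term character sum -/

/-- **The `d+id` gap function is a character sum over the eight bond vectors**: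
`2Δ₁(cos θ₀ - cos θ₁) - 4iΔ₂ sin θ₀ sin θ₁ = Σ_{r∈B} c_r e^{i r·θ}` with
`B = {±e₀, ±e₁, ±(e₀+e₁), ±(e₀-e₁)}`, `c_{±e₀} = Δ₁`, `c_{±e₁} = -Δ₁`, `c_{±(e₀+e₁)} = iΔ₂`,
`c_{±(e₀-e₁)} = -iΔ₂` (`-4 sin a sin b = 2cos(a+b) - 2cos(a-b)`). [folklore] -/
theorem gap_eq_sum_bondCoeff_mul_exp (Δ₁ Δ₂ θ₀ θ₁ : ℝ) :
    ((2 * Δ₁ * (Real.cos θ₀ - Real.cos θ₁) : ℝ) : ℂ) - 4 * Complex.I * ((Δ₂ * Real.sin θ₀ * Real.sin θ₁ : ℝ) : ℂ) =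
      ∑ r ∈ ({(1, 0), (-1, 0), (0, 1), (0, -1), (1, 1), (-1, -1), (1, -1), (-1, 1)} : Finset (ℤ × ℤ)),
        (if (r = (1, 0) ∨ r = (-1, 0)) then (Δ₁ : ℂ) else if (r = (0, 1) ∨ r = (0, -1)) then -(Δ₁ : ℂ)
          else if (r = (1, 1) ∨ r = (-1, -1)) then Complex.I * (Δ₂ : ℂ) else -(Complex.I * (Δ₂ : ℂ))) *
        Complex.exp (Complex.I * ((r.1 * θ₀ + r.2 * θ₁ : ℝ) : ℂ)) := by
  rw [Finset.sum_insert (by decide), Finset.sum_insert (by decide), Finset.sum_insert (by decide),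
    Finset.sum_insert (by decide), Finset.sum_insert (by decide), Finset.sum_insert (by decide),
    Finset.sum_insert (by decide), Finset.sum_singleton]
  simp only [Prod.mk.injEq, and_true, true_or, or_true, if_true, if_false, and_false, or_false,
    false_or, one_ne_zero, zero_ne_one, neg_eq_zero, Int.reduceNeg]
  norm_num
  have hexp : ∀ x : ℂ, Complex.exp (Complex.I * x) = Complex.cos x + Complex.sin x * Complex.I := fun x => by
    rw [mul_comm, Complex.exp_mul_I]
  have hexp' : ∀ x : ℂ, Complex.exp (-(Complex.I * x)) = Complex.cos x - Complex.sin x * Complex.I := fun x => by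
    rw [← mul_neg, hexp, Complex.cos_neg, Complex.sin_neg]
    ring
  simp only [hexp, hexp', Complex.cos_add, Complex.sin_add, Complex.cos_neg, Complex.sin_neg]
  ring

end BirBdG

end Summit.HubbardSuperconductivity.HubbardSuperconductivity.Theorems

end
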